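import Summits.HubbardSuperconductivity.HubbardSuperconductivity.Theorems.InfiniteVolumeFirstNoInfraredPileUpThermalRewardChord
import HarnessLib

/-!
# Crux `NoInfraredPileUp` (stmt-HubbardSuperconductivity-18534, route `InfiniteVolumeFirst`) —
# thermal reward chord: the zero-temperature form implies the thermal form

Companion of `InfiniteVolumeFirstNoInfraredPileUpThermalRewardChord` (the engine-facing re-cut of crux
r3: a thermal REWARD chord on two sector partition functions, or `T = 0` reward stability of the sector
ground-state energy, bounds the open-window pair weight `Σ_{m ≠ 0, |q_m| ≤ ε} S_ψ(m)` of EVERY ground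
state). Here the two hypotheses are compared: the thermal one asks NO MORE than the zero-temperature one.

* `openWindowReward_mulVec_mem_szSector` — `W'_ε` preserves every sector `(2n, S^z = M)`, `n ≥ 1`;
* `thermalChord_of_strict_chord_szSector` — generic in the observable: on the Hubbard torus, for any
  Hermitian `A` preserving the sector `K = szSector (2n) 0` (`n ≤ L²`), a STRICT `T = 0` chord
  `κ a < minEnergyOn (H + κA) K − minEnergyOn H K` gives some `β > 0` with the thermal chord
  `β κ a + L² log 4 ≤ log re tr (P_K e^{-βH}) − log re tr (P_K e^{-β(H + κA)})` (one ground state below,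
  entropy budget `dim K ≤ 4^{L²}` above, `β = (2L² log 4 + 1)/margin`) — the pattern of
  `Theorems.thermalChord_of_strict_kappaChord` and `NoNormalLimitState.thermalWindowChord_of_strict_windowGap`;
* `thermalRewardChord_of_strict_rewardStability` — the instance `A = −W'_ε`, `a = −η L²`;
* `stub_thermalRewardChordOfRewardStability` — `T = 0` reward stability at every `η` (the hypothesis of
  `stub_rewardStabilityTransfer`) implies the thermal reward chords (the hypothesis of
  `stub_thermalRewardChordTransfer`): instantiate at `η/2` for a strict margin. So:
  reward stability ⇒ thermal reward chords ⇒ `NoInfraredPileUp`.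

Pure finite-dimensional algebra over landed lemmas; no definition and no named fact is introduced.
Sources: B. Simon, *The Statistical Mechanics of Lattice Gases* I (1993) §II.13; Bratteli–Robinson II
§5.3.1; Tasaki (2020) App. A, §2.1.
-/

noncomputable section

-- the mandated namespace `Summit.<Summit>.<Problem>.Theorems` repeats `HubbardSuperconductivity`
-- (single-problem summit, D-0017), which the `dupNamespace` linter flags on every declaration
set_option linter.dupNamespace false

namespace Summit.HubbardSuperconductivity.HubbardSuperconductivity.Theorems.NoInfraredPileUp

open Literature.MathematicalPhysics.QuantumLattice Literature.Probability.LatticeModels Matrix Finset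
  Filter
open Summit.HubbardSuperconductivity.HubbardSuperconductivity.Theses
open scoped ComplexConjugate ComplexOrder Topology

/-! ### The open-window operator preserves the sectors -/

/-- The open-window operator preserves every joint sector `(2n, S^z = M)` with `n ≥ 1`
(`Δ_d(m)` lowers the particle number by two at fixed `S^z`, `Δ_d(m)ᴴ` raises it back).
Tasaki (2020) §9.3. [folklore] -/
theorem openWindowReward_mulVec_mem_szSector (L : ℕ) [NeZero L] (ε : ℝ) {n : ℕ} (hn : 1 ≤ n) {M : ℝ}
    {v : Fock (Orb (FermionTorus 2 L))} (hv : v ∈ szSector (Λ := FermionTorus 2 L) (2 * n) M) :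
    (∑ m : Fin 2 → ZMod L, if m ≠ 0 ∧ momentumNormSq L m ≤ ε ^ 2 then
        ((L : ℂ) ^ 2)⁻¹ • ((pairFieldAt dWaveFormFactor L m)ᴴ * pairFieldAt dWaveFormFactor L m)
        else 0) *ᵥ v ∈ szSector (Λ := FermionTorus 2 L) (2 * n) M := by
  rw [sum_mulVec]
  refine Submodule.sum_mem _ fun m _ => ?_
  split_ifs with hm
  · rw [smul_mulVec, ← mulVec_mulVec]
    refine Submodule.smul_mem _ _ ?_
    have h2 : 2 ≤ 2 * n := by omega
    have h := WcbcsSsbToTorusLRO.conjTranspose_pairFieldAt_mulVec_mem_szSector dWaveFormFactor m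
      (WcbcsSsbToTorusLRO.pairFieldAt_mulVec_mem_szSector dWaveFormFactor m h2 hv)
    rwa [show 2 * n - 2 + 2 = 2 * n by omega] at h
  · rw [zero_mulVec]
    exact Submodule.zero_mem _

/-! ### `T = 0` ⇒ thermal: the thermal reward chord asks no more than reward stability -/

/-- **A strict zero-temperature chord gives the thermal chord, for any Hermitian sector-preserving
observable** (the pattern of `Theorems.thermalChord_of_strict_kappaChord` /
`NoNormalLimitState.thermalWindowChord_of_strict_windowGap`, made generic in the observable). Side
`L ≥ 1`, sector `K = szSector (2n) 0` with `n ≤ L²` (non-empty), `H = hubbardTorus 2 L 1 U`, `A`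
Hermitian with `A K ⊆ K`, real `κ`, `a`: if `κ a < minEnergyOn (H + κ A) K − minEnergyOn H K`, then
some `β > 0` has `β κ a + L² log 4 ≤ log re tr (P_K e^{-βH}) − log re tr (P_K e^{-β(H + κ A)})`
(`log re tr (P_K e^{-βH}) ≥ −β e₀(H)` by one ground state; `log re tr (P_K e^{-β(H + κA)}) ≤
L² log 4 − β e₀(H + κA)` by the entropy budget; `β = (2L² log 4 + 1)/margin`).
B. Simon (1993) §II.13; Tasaki (2020) App. A. [folklore] -/
theorem thermalChord_of_strict_chord_szSector (L : ℕ) [NeZero L] (U : ℝ) {n : ℕ} (hnL : n ≤ L ^ 2)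
    {A : Matrix (Finset (Orb (FermionTorus 2 L))) (Finset (Orb (FermionTorus 2 L))) ℂ}
    (hA : A.IsHermitian)
    (hAS : ∀ v ∈ szSector (Λ := FermionTorus 2 L) (2 * n) 0,
      A *ᵥ v ∈ szSector (Λ := FermionTorus 2 L) (2 * n) 0)
    (κ a : ℝ)
    (hgap : κ * a < (hubbardTorus 2 L 1 U + (κ : ℂ) • A).minEnergyOn
        (szSector (Λ := FermionTorus 2 L) (2 * n) 0) -
      (hubbardTorus 2 L 1 U).minEnergyOn (szSector (Λ := FermionTorus 2 L) (2 * n) 0)) :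
    ∃ β : ℝ, 0 < β ∧
      β * κ * a + (L : ℝ) ^ 2 * Real.log 4 ≤
        Real.log (projMatrix ((szSector (Λ := FermionTorus 2 L) (2 * n) 0).map
            (Fock.toEuclidean (ι := Orb (FermionTorus 2 L)) :
              Fock (Orb (FermionTorus 2 L)) →ₗ[ℂ] EuclideanSpace ℂ (Finset (Orb (FermionTorus 2 L))))) *
            gibbsWeight β (hubbardTorus 2 L 1 U)).trace.re -
          Real.log (projMatrix ((szSector (Λ := FermionTorus 2 L) (2 * n) 0).map
            (Fock.toEuclidean (ι := Orb (FermionTorus 2 L)) :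
              Fock (Orb (FermionTorus 2 L)) →ₗ[ℂ] EuclideanSpace ℂ (Finset (Orb (FermionTorus 2 L))))) *
            gibbsWeight β (hubbardTorus 2 L 1 U + (κ : ℂ) • A)).trace.re := by
  set H := hubbardTorus 2 L 1 U with hHdef
  set S := szSector (Λ := FermionTorus 2 L) (2 * n) 0 with hSdef
  set PS := projMatrix (S.map (Fock.toEuclidean (ι := Orb (FermionTorus 2 L)) :
    Fock (Orb (FermionTorus 2 L)) →ₗ[ℂ] EuclideanSpace ℂ (Finset (Orb (FermionTorus 2 L)))))
    with hPSdef
  set e₀ : ℝ := H.minEnergyOn S with he₀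
  set e₁ : ℝ := (H + (κ : ℂ) • A).minEnergyOn S with he₁
  set B : ℝ := (L : ℝ) ^ 2 * Real.log 4 with hB
  have hB0 : 0 ≤ B := by positivity
  set mg : ℝ := e₁ - e₀ - κ * a with hmg
  have hmg0 : 0 < mg := by rw [hmg]; linarith
  -- the objects
  have hH : H.IsHermitian := LiebThm1.hamiltonian_isHermitian (fermionTorusGraph 2 L) 1 U
  have hX : (H + (κ : ℂ) • A).IsHermitian :=
    hH.add (hA.smul (by rw [isSelfAdjoint_iff, Complex.star_def, Complex.conj_ofReal]))
  have hinvH : ∀ v ∈ S, H *ᵥ v ∈ S := fun v hv => szSector_invariant_hubbardTorus 2 L 1 U _ hv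
  have hinvX : ∀ v ∈ S, (H + (κ : ℂ) • A) *ᵥ v ∈ S := by
    intro v hv
    rw [add_mulVec, smul_mulVec]
    exact S.add_mem (hinvH v hv) (S.smul_mem _ (hAS v hv))
  -- a normalised sector ground state of `H`
  obtain ⟨ψ, hψ, hgs⟩ :=
    Literature.Barriers.HubbardSuperconductivity.exists_unit_isGroundStateInSector_hubbardTorus U L n hnL
  have hRH : (star ψ ⬝ᵥ H *ᵥ ψ).re = e₀ := by
    rw [hgs.2.2, dotProduct_smul, hψ, smul_eq_mul, mul_one, Complex.ofReal_re]
  -- choose `β`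
  refine ⟨(2 * B + 1) / mg, by positivity, ?_⟩
  set β : ℝ := (2 * B + 1) / mg with hβdef
  have hβ : 0 < β := by positivity
  have hβm : β * mg = 2 * B + 1 := by rw [hβdef, div_mul_cancel₀ _ hmg0.ne']
  -- lower bound on `Z_S(β, H)`
  have hZ0 : Real.exp (-(β * e₀)) ≤ (PS * gibbsWeight β H).trace.re := by
    rw [← hRH]
    exact (Theorems.exp_neg_mul_rayleigh_le_re_gibbsWeight hH β hψ).trans
      (Theorems.re_rayleigh_le_re_trace_projMatrix_mul (posDef_gibbsWeight β hH).posSemidef S hgs.1 hψ)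
  -- upper bound on `Z_S(β, H + κA)` by the entropy budget, and positivity
  have hZ1 : (PS * gibbsWeight β (H + (κ : ℂ) • A)).trace.re ≤
      (Module.finrank ℂ S : ℝ) * Real.exp (-(β * e₁)) :=
    Theorems.re_trace_sectorProj_mul_gibbsWeight_le hX S hinvX hβ.le
  have hZ1pos : 0 < (PS * gibbsWeight β (H + (κ : ℂ) • A)).trace.re :=
    (Real.exp_pos _).trans_le ((Theorems.exp_neg_mul_rayleigh_le_re_gibbsWeight hX β hψ).trans
      (Theorems.re_rayleigh_le_re_trace_projMatrix_mul (posDef_gibbsWeight β hX).posSemidef S hgs.1 hψ))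
  have hd1 : (1 : ℝ) ≤ Module.finrank ℂ S := by
    have : 0 < Module.finrank ℂ S := Module.finrank_pos_iff_exists_ne_zero.mpr
      ⟨⟨ψ, hgs.1⟩, fun h0 => hgs.2.1 (by simpa using congrArg Subtype.val h0)⟩
    exact_mod_cast this
  have hbudget : Real.log (Module.finrank ℂ S) ≤ B := by
    have h4 : (Module.finrank ℂ S : ℝ) ≤ (4 : ℝ) ^ (L ^ 2) := by
      exact_mod_cast Theorems.finrank_szSector_fermionTorus_le L (2 * n) 0
    calc Real.log (Module.finrank ℂ S) ≤ Real.log ((4 : ℝ) ^ (L ^ 2)) :=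
          Real.log_le_log (by linarith) h4
      _ = B := by rw [hB, Real.log_pow]; push_cast; ring
  -- logarithms
  have hl0 : -(β * e₀) ≤ Real.log (PS * gibbsWeight β H).trace.re := by
    rw [← Real.log_exp (-(β * e₀))]
    exact Real.log_le_log (Real.exp_pos _) hZ0
  have hl1 : Real.log (PS * gibbsWeight β (H + (κ : ℂ) • A)).trace.re ≤
      Real.log (Module.finrank ℂ S) + -(β * e₁) := by
    rw [← Real.log_exp (-(β * e₁)), ← Real.log_mul (by positivity) (Real.exp_pos _).ne']
    exact Real.log_le_log hZ1pos hZ1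
  have hme : β * e₁ - β * e₀ = β * mg + β * (κ * a) := by rw [hmg]; ring
  nlinarith [hl0, hl1, hbudget, hβm, hme, hB0]

/-- **Strict reward stability at `T = 0` gives the thermal reward chord.** Side `L ≥ 1`, sector
`K = szSector (2n) 0` with `1 ≤ n ≤ L²`, `λ`, `η` real: if
`minEnergyOn H K − minEnergyOn (H − λ W'_ε) K < λ (η L²)` strictly, then some `β > 0` has
`log re tr (P_K e^{-β(H − λW'_ε)}) − log re tr (P_K e^{-βH}) + L² log 4 ≤ β λ (η L²)`
(`thermalChord_of_strict_chord_szSector` with `A = −W'_ε`, `a = −η L²`). B. Simon (1993) §II.13.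
[folklore] -/
theorem thermalRewardChord_of_strict_rewardStability (L : ℕ) [NeZero L] (U ε : ℝ) {n : ℕ}
    (hn : 1 ≤ n) (hnL : n ≤ L ^ 2) (lam η : ℝ)
    (hstab : (hubbardTorus 2 L 1 U).minEnergyOn (szSector (Λ := FermionTorus 2 L) (2 * n) 0) -
      (hubbardTorus 2 L 1 U - (lam : ℂ) • ∑ m : Fin 2 → ZMod L,
          if m ≠ 0 ∧ momentumNormSq L m ≤ ε ^ 2 then
            ((L : ℂ) ^ 2)⁻¹ • ((pairFieldAt dWaveFormFactor L m)ᴴ * pairFieldAt dWaveFormFactor L m)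
          else 0).minEnergyOn (szSector (Λ := FermionTorus 2 L) (2 * n) 0) < lam * (η * (L : ℝ) ^ 2)) :
    ∃ β : ℝ, 0 < β ∧
      Real.log (projMatrix ((szSector (Λ := FermionTorus 2 L) (2 * n) 0).map
          (Fock.toEuclidean (ι := Orb (FermionTorus 2 L)) :
            Fock (Orb (FermionTorus 2 L)) →ₗ[ℂ] EuclideanSpace ℂ (Finset (Orb (FermionTorus 2 L))))) *
          gibbsWeight β (hubbardTorus 2 L 1 U - (lam : ℂ) • ∑ m : Fin 2 → ZMod L,
            if m ≠ 0 ∧ momentumNormSq L m ≤ ε ^ 2 then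
              ((L : ℂ) ^ 2)⁻¹ • ((pairFieldAt dWaveFormFactor L m)ᴴ * pairFieldAt dWaveFormFactor L m)
            else 0)).trace.re -
        Real.log (projMatrix ((szSector (Λ := FermionTorus 2 L) (2 * n) 0).map
          (Fock.toEuclidean (ι := Orb (FermionTorus 2 L)) :
            Fock (Orb (FermionTorus 2 L)) →ₗ[ℂ] EuclideanSpace ℂ (Finset (Orb (FermionTorus 2 L))))) *
          gibbsWeight β (hubbardTorus 2 L 1 U)).trace.re +
        (L : ℝ) ^ 2 * Real.log 4 ≤ β * lam * (η * (L : ℝ) ^ 2) := by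
  set H := hubbardTorus 2 L 1 U with hHdef
  set W : Matrix (Finset (Orb (FermionTorus 2 L))) (Finset (Orb (FermionTorus 2 L))) ℂ :=
    ∑ m : Fin 2 → ZMod L, if m ≠ 0 ∧ momentumNormSq L m ≤ ε ^ 2 then
      ((L : ℂ) ^ 2)⁻¹ • ((pairFieldAt dWaveFormFactor L m)ᴴ * pairFieldAt dWaveFormFactor L m)
      else 0 with hWdef
  have hHA : H - (lam : ℂ) • W = H + (lam : ℂ) • (-W) := by rw [smul_neg, sub_eq_add_neg]
  rw [hHA] at hstab ⊢
  have hA : (-W).IsHermitian := (openWindowReward_isHermitian L ε).neg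
  have hAS : ∀ v ∈ szSector (Λ := FermionTorus 2 L) (2 * n) 0,
      (-W) *ᵥ v ∈ szSector (Λ := FermionTorus 2 L) (2 * n) 0 := by
    intro v hv
    rw [neg_mulVec]
    exact Submodule.neg_mem _ (openWindowReward_mulVec_mem_szSector L ε hn hv)
  have hgap : lam * (-(η * (L : ℝ) ^ 2)) < (H + (lam : ℂ) • (-W)).minEnergyOn
      (szSector (Λ := FermionTorus 2 L) (2 * n) 0) -
      H.minEnergyOn (szSector (Λ := FermionTorus 2 L) (2 * n) 0) := by linarith
  obtain ⟨β, hβ, hch⟩ := thermalChord_of_strict_chord_szSector L U hnL hA hAS lam (-(η * (L : ℝ) ^ 2)) hgap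
  refine ⟨β, hβ, ?_⟩
  linarith

/-- **`T = 0` reward stability (at every `η`) implies the thermal reward chords** — the hypothesis of
`stub_rewardStabilityTransfer` implies that of `stub_thermalRewardChordTransfer`: instantiate
stability at `η/2` (a strict margin for `η`, as `λ η L² > 0`), then
`thermalRewardChord_of_strict_rewardStability` (`1 ≤ ⌊(1−δ)L²/2⌋ ≤ L²` once `L ≥ 2`). So the
engine-facing thermal line asks no more than the zero-temperature one:
`reward stability ⇒ thermal reward chords ⇒ NoInfraredPileUp`. (Sub-goal
`stub_thermalRewardChordOfRewardStability` registered on the item; statement on one line, verbatim the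
registered text.) B. Simon (1993) §II.13; Tasaki (2020) §2.1. [folklore] -/
theorem stub_thermalRewardChordOfRewardStability :
    (∀ δ ∈ Set.Ioo (0:ℝ) (1 / 2), ∃ U₁ : ℝ, 0 < U₁ ∧ ∀ U ∈ Set.Ioo (0:ℝ) U₁, ∀ η : ℝ, 0 < η → ∃ ε : ℝ, 0 < ε ∧ ∃ L₀ : ℕ, ∀ (L : ℕ) [NeZero L], Even L → L₀ ≤ L → ∃ lam : ℝ, 0 < lam ∧ (hubbardTorus 2 L 1 U).minEnergyOn (szSector (Λ := FermionTorus 2 L) (2 * ⌊(1 - δ) * (L : ℝ) ^ 2 / 2⌋₊) 0) - (hubbardTorus 2 L 1 U - (lam : ℂ) • ∑ m : Fin 2 → ZMod L, if m ≠ 0 ∧ momentumNormSq L m ≤ ε ^ 2 then ((L : ℂ) ^ 2)⁻¹ • ((pairFieldAt dWaveFormFactor L m)ᴴ * pairFieldAt dWaveFormFactor L m) else 0).minEnergyOn (szSector (Λ := FermionTorus 2 L) (2 * ⌊(1 - δ) * (L : ℝ) ^ 2 / 2⌋₊) 0) ≤ lam * (η * (L : ℝ) ^ 2)) → (∀ δ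 ∈ Set.Ioo (0:ℝ) (1 / 2), ∃ U₁ : ℝ, 0 < U₁ ∧ ∀ U ∈ Set.Ioo (0:ℝ) U₁, ∀ η : ℝ, 0 < η → ∃ ε : ℝ, 0 < ε ∧ ∃ L₀ : ℕ, ∀ (L : ℕ) [NeZero L], Even L → L₀ ≤ L → ∃ lam : ℝ, 0 < lam ∧ ∃ β : ℝ, 0 < β ∧ Real.log (projMatrix ((szSector (Λ := FermionTorus 2 L) (2 * ⌊(1 - δ) * (L : ℝ) ^ 2 / 2⌋₊) 0).map (Fock.toEuclidean (ι := Orb (FermionTorus 2 L)) : Fock (Orb (FermionTorus 2 L)) →ₗ[ℂ] EuclideanSpace ℂ (Finset (Orb (FermionTorus 2 L))))) * gibbsWeight β (hubbardTorus 2 L 1 U - (lam : ℂ) • ∑ m : Fin 2 → ZMod L, if m ≠ 0 ∧ momentumNormSq L m ≤ ε ^ 2 then ((L : ℂ) ^ 2)⁻¹ • ((pairFieldAt dWaveFormFactor L m)ᴴ * pairFieldAt dWaveFormFactor L m) else 0)).trace.re - Real.log (projMatrix ((szSector (Λ := FermionTorus 2 L) (2 * ⌊(1 - δ) * (L : ℝ)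 ^ 2 / 2⌋₊) 0).map (Fock.toEuclidean (ι := Orb (FermionTorus 2 L)) : Fock (Orb (FermionTorus 2 L)) →ₗ[ℂ] EuclideanSpace ℂ (Finset (Orb (FermionTorus 2 L))))) * gibbsWeight β (hubbardTorus 2 L 1 U)).trace.re + (L : ℝ) ^ 2 * Real.log 4 ≤ β * lam * (η * (L : ℝ) ^ 2)) := by
  intro hst δ hδ
  obtain ⟨U₁, hU₁, hall⟩ := hst δ hδ
  refine ⟨U₁, hU₁, fun U hU η hη => ?_⟩
  obtain ⟨ε, hε, L₀, hL₀⟩ := hall U hU (η / 2) (half_pos hη)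
  refine ⟨ε, hε, max L₀ 2, fun L _ hLe hLge => ?_⟩
  have hL0 : L₀ ≤ L := le_trans (le_max_left _ _) hLge
  have hL2 : 2 ≤ L := le_trans (le_max_right _ _) hLge
  obtain ⟨lam, hlam, hstab⟩ := hL₀ L hLe hL0
  refine ⟨lam, hlam, ?_⟩
  -- the sector is non-empty and carries at least one pair: `1 ≤ ⌊(1-δ)L²/2⌋ ≤ L²`
  have hn1 : 1 ≤ ⌊(1 - δ) * (L : ℝ) ^ 2 / 2⌋₊ := by
    refine Nat.le_floor ?_
    have hL2' : (2 : ℝ) ≤ (L : ℝ) := by exact_mod_cast hL2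
    have hδ2 : (1 : ℝ) / 2 ≤ 1 - δ := by linarith [hδ.2]
    have hLsq : (4 : ℝ) ≤ (L : ℝ) ^ 2 := by nlinarith
    rw [Nat.cast_one, le_div_iff₀ (by norm_num : (0 : ℝ) < 2)]
    nlinarith
  have hnL : ⌊(1 - δ) * (L : ℝ) ^ 2 / 2⌋₊ ≤ L ^ 2 := by
    refine Nat.floor_le_of_le ?_
    have hL : (0 : ℝ) ≤ (L : ℝ) ^ 2 := by positivity
    push_cast
    nlinarith [hδ.1]
  -- strictness: `λ (η/2) L² < λ η L²`
  have hLpos : (0 : ℝ) < (L : ℝ) ^ 2 := by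
    have : (0 : ℝ) < (L : ℝ) := by exact_mod_cast lt_of_lt_of_le (by norm_num : 0 < 2) hL2
    positivity
  have hpos : 0 < lam * (η * (L : ℝ) ^ 2) := by positivity
  have hstrict : (hubbardTorus 2 L 1 U).minEnergyOn
        (szSector (Λ := FermionTorus 2 L) (2 * ⌊(1 - δ) * (L : ℝ) ^ 2 / 2⌋₊) 0) -
      (hubbardTorus 2 L 1 U - (lam : ℂ) • ∑ m : Fin 2 → ZMod L,
          if m ≠ 0 ∧ momentumNormSq L m ≤ ε ^ 2 then
            ((L : ℂ) ^ 2)⁻¹ • ((pairFieldAt dWaveFormFactor L m)ᴴ * pairFieldAt dWaveFormFactor L m)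
          else 0).minEnergyOn (szSector (Λ := FermionTorus 2 L) (2 * ⌊(1 - δ) * (L : ℝ) ^ 2 / 2⌋₊) 0) <
      lam * (η * (L : ℝ) ^ 2) := by
    have hhalf : lam * (η / 2 * (L : ℝ) ^ 2) = lam * (η * (L : ℝ) ^ 2) / 2 := by ring
    rw [hhalf] at hstab
    linarith
  exact thermalRewardChord_of_strict_rewardStability L U ε hn1 hnL lam η hstrict

end Summit.HubbardSuperconductivity.HubbardSuperconductivity.Theorems.NoInfraredPileUp

end
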